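import Summits.Schanuel.Schanuel.Theorems.ZilberEacRealLineCore
import HarnessLib

/-!
# Totally real hyperplane × graph curve (2/3): the analytic core in several fibre coordinates

Zilber's Exponential-Algebraic Closedness, case ladder (host summit Schanuel, cell `pub-schanuel`,
seat 2, gen 7).  Second of three files on the `(s+1)`-folds
`W = {x_{s+1} = Σⱼ rⱼ xⱼ + c, yⱼ = qⱼ(y_{s+1})}` with real `rⱼ`; see `ZilberEacRealSplit`.

**HONEST FRAMING.** Existence of exponential points on split varieties `L × W` (`L` linear) is in
print (Gallinaro, Selecta Math. 29 (2023) Thm 8.8); new are the unconditional kernel proof and the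
method.  Nothing here bears on Schanuel's conjecture (EAC ⇏ SC); `ECCell 3 2` stays OPEN.

Contents:
* `prod_eq_zero_of_forall_logDeriv_rel` — if `1/u = Σⱼ rⱼ qⱼ'(u)/qⱼ(u)` on an infinite set then
  `Σⱼ rⱼ deg qⱼ = 1` (compare top coefficients of `∏ qⱼ = u · Σⱼ rⱼ qⱼ' ∏_{i ≠ j} qᵢ`).
* `realSplit_core` — THE ENGINE (the `s`-coordinate version of `ZilberEacRealLineCore.realLine_core`):
  at a point `u₀` of the level set `log |u| = Σⱼ rⱼ log |qⱼ(u)| + Re c` the holomorphic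
  `L(u) = log u - Σⱼ rⱼ log qⱼ(u) - c` (local branches) is purely imaginary and not locally constant
  (`Σⱼ rⱼ deg qⱼ ≠ 1`), so by the OPEN MAPPING THEOREM it attains near every point of its imaginary
  level set every value `2πi(m + r_{j₀} k)` with `|k|` large (`r_{j₀}` irrational:
  `exists_int_int_near_of_irrational`); such a `u` IS an exponential point of `W`:
  `xⱼ = log qⱼ(u) + 2πik[j = j₀]`, `y_{s+1} = u`.  Output: an infinite set of fibre values each the
  limit of fibre coordinates `y_{s+1}` of exponential points whose `x_{j₀}` tends to infinity.
-/

noncomputable section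

open MvPolynomial Filter Topology Complex Metric
open Literature.NumberTheory.Transcendental Literature.ModelTheory.Zilber
  Literature.ModelTheory.ExponentialFields

set_option linter.dupNamespace false

namespace Summit.Schanuel.Schanuel.Theorems

section SplitCore

variable {s : ℕ}

/-- **Top coefficients.** If `∏ⱼ qⱼ = X · Σⱼ rⱼ · qⱼ' · ∏_{i ≠ j} qᵢ` in `ℂ[X]` (all `qⱼ ≠ 0`) then
`Σⱼ rⱼ deg qⱼ = 1`: compare the coefficients of `X^{Σ deg qⱼ}`. -/
theorem sum_mul_natDegree_eq_one_of_prod_eq (r : Fin s → ℝ) {q : Fin s → Polynomial ℂ}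
    (hq : ∀ j, q j ≠ 0)
    (h : ∏ j, q j = Polynomial.X * ∑ j, Polynomial.C (r j : ℂ) *
      (Polynomial.derivative (q j) * ∏ i ∈ Finset.univ.erase j, q i)) :
    ∑ j, r j * ((q j).natDegree : ℝ) = 1 := by
  classical
  set N : ℕ := ∑ j, (q j).natDegree with hN
  set Λ : ℂ := ∏ j, (q j).leadingCoeff with hΛ
  have hΛ0 : Λ ≠ 0 := Finset.prod_ne_zero_iff.2 fun j _ => Polynomial.leadingCoeff_ne_zero.2 (hq j)
  have hPdeg : (∏ j, q j).natDegree = N := Polynomial.natDegree_prod _ _ fun j _ => hq j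
  have hPlc : (∏ j, q j).coeff N = Λ := by
    rw [← hPdeg, Polynomial.coeff_natDegree, Polynomial.leadingCoeff_prod]
  -- the coefficient of `X^{N-1}` in `qⱼ' ∏_{i ≠ j} qᵢ` is `deg qⱼ · Λ`
  have hT : ∀ j, 1 ≤ N → (Polynomial.derivative (q j) * ∏ i ∈ Finset.univ.erase j, q i).coeff
      (N - 1) = ((q j).natDegree : ℂ) * Λ := by
    intro j hN1
    have herase : (∏ i ∈ Finset.univ.erase j, q i).natDegree =
        ∑ i ∈ Finset.univ.erase j, (q i).natDegree :=
      Polynomial.natDegree_prod _ _ fun i _ => hq i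
    have hsumerase : (q j).natDegree + ∑ i ∈ Finset.univ.erase j, (q i).natDegree = N := by
      rw [hN, ← Finset.add_sum_erase _ _ (Finset.mem_univ j)]
    have hΛj : (q j).leadingCoeff * (∏ i ∈ Finset.univ.erase j, q i).leadingCoeff = Λ := by
      rw [Polynomial.leadingCoeff_prod, hΛ, ← Finset.mul_prod_erase _ _ (Finset.mem_univ j)]
    rcases Nat.eq_zero_or_pos (q j).natDegree with hD0 | hDpos
    · -- constant `qⱼ`: derivative zero
      rw [Polynomial.derivative_of_natDegree_zero hD0, zero_mul, Polynomial.coeff_zero, hD0,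
        Nat.cast_zero, zero_mul]
    · have hidx : N - 1 = ((q j).natDegree - 1) + ∑ i ∈ Finset.univ.erase j, (q i).natDegree := by
        omega
      have hn : (q j).natDegree - 1 + 1 = (q j).natDegree := Nat.sub_add_cancel hDpos
      have hc : (((q j).natDegree - 1 : ℕ) : ℂ) + 1 = ((q j).natDegree : ℂ) := by
        exact_mod_cast hn
      rw [hidx, Polynomial.coeff_mul_add_eq_of_natDegree_le (Polynomial.natDegree_derivative_le _)
        herase.le, Polynomial.coeff_derivative, hn, hc, ← herase,
        Polynomial.coeff_natDegree, Polynomial.coeff_natDegree, ← hΛj]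
      ring
  rcases Nat.eq_zero_or_pos N with hN0 | hNpos
  · -- all `qⱼ` constant: `∏ qⱼ` is a nonzero constant, but the right side has no constant term
    exfalso
    have h0 := congrArg (fun P => Polynomial.coeff P 0) h
    simp only [Polynomial.mul_coeff_zero, Polynomial.coeff_X_zero, zero_mul] at h0
    rw [hN0] at hPlc
    rw [hPlc] at h0
    exact hΛ0 h0
  · have h1 := congrArg (fun P => Polynomial.coeff P N) h
    simp only at h1
    obtain ⟨N', hN'⟩ : ∃ N', N = N' + 1 := ⟨N - 1, by omega⟩
    rw [hPlc, hN', Polynomial.coeff_X_mul, Polynomial.finsetSum_coeff] at h1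
    simp only [Polynomial.coeff_C_mul] at h1
    have hN'eq : N' = N - 1 := by omega
    rw [hN'eq] at h1
    simp only [fun j => hT j hNpos] at h1
    have h2 : Λ * (1 - ∑ j, (r j : ℂ) * ((q j).natDegree : ℂ)) = 0 := by
      rw [mul_sub, mul_one, Finset.mul_sum]
      have h6 : ∑ j, Λ * ((r j : ℂ) * ((q j).natDegree : ℂ)) =
          ∑ j, (r j : ℂ) * (((q j).natDegree : ℂ) * Λ) :=
        Finset.sum_congr rfl fun j _ => by ring
      rw [h6, ← h1, sub_self]
    have h3 : (1 : ℂ) - ∑ j, (r j : ℂ) * ((q j).natDegree : ℂ) = 0 :=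
      (mul_eq_zero.1 h2).resolve_left hΛ0
    have h4 : ((∑ j, r j * ((q j).natDegree : ℝ) : ℝ) : ℂ) = 1 := by
      push_cast
      linear_combination -h3
    exact_mod_cast h4

/-- **The analytic core, several fibre coordinates.** Let `r : Fin s → ℝ` with `r j₀` irrational,
`c ∈ ℂ`, `qⱼ ∈ ℂ[u]` with `Σⱼ rⱼ deg qⱼ ≠ 1`, and `u₀ ≠ 0` a point with all `qⱼ(u₀) ≠ 0` on the level
set `log |u₀| = Σⱼ rⱼ log |qⱼ(u₀)| + Re c`.  Then there is an INFINITE set `A ⊆ ℂ` of fibre values each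
of which is the limit of the last fibre coordinates `w_k` of exponential points of
`{x_{s+1} = Σⱼ rⱼ xⱼ + c, yⱼ = qⱼ(y_{s+1})}` — `e^{xⱼ} = qⱼ(w)`, `e^{Σ rⱼ xⱼ + c} = w` — whose
`j₀`-th coordinate tends to infinity. -/
theorem realSplit_core (r : Fin s → ℝ) {j₀ : Fin s} (hj₀ : Irrational (r j₀)) (c : ℂ)
    {q : Fin s → Polynomial ℂ} (hdeg : ∑ j, r j * ((q j).natDegree : ℝ) ≠ 1) {u₀ : ℂ}
    (hu₀ : u₀ ≠ 0) (hq₀ : ∀ j, (q j).eval u₀ ≠ 0)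
    (hlev : Real.log ‖u₀‖ = ∑ j, r j * Real.log ‖(q j).eval u₀‖ + c.re) :
    ∃ A : Set ℂ, A.Infinite ∧ ∀ α ∈ A, ∃ (x : ℕ → Fin s → ℂ) (w : ℕ → ℂ),
      Tendsto (fun k => ‖x k j₀‖) atTop atTop ∧ Tendsto w atTop (𝓝 α) ∧
      ∀ k, (∀ j, exp (x k j) = (q j).eval (w k)) ∧ exp (∑ j, (r j : ℂ) * x k j + c) = w k := by
  classical
  have hq : ∀ j, q j ≠ 0 := by
    intro j h0
    exact hq₀ j (by rw [h0, Polynomial.eval_zero])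
  -- Step 0: a ball around `u₀` on which all local logarithms are holomorphic
  obtain ⟨r₀, hr₀, hrD⟩ : ∃ r₀ > 0, ∀ u ∈ ball u₀ r₀,
      u / u₀ ∈ slitPlane ∧ ∀ j, (q j).eval u / (q j).eval u₀ ∈ slitPlane := by
    have h1 : ∀ᶠ u in 𝓝 u₀, u / u₀ ∈ slitPlane := by
      have hc : ContinuousAt (fun u : ℂ => u / u₀) u₀ := (continuous_id.div_const u₀).continuousAt
      refine hc.eventually_mem (isOpen_slitPlane.mem_nhds ?_)
      rw [div_self hu₀]
      exact one_mem_slitPlane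
    have h2 : ∀ j, ∀ᶠ u in 𝓝 u₀, (q j).eval u / (q j).eval u₀ ∈ slitPlane := by
      intro j
      have hc : ContinuousAt (fun u : ℂ => (q j).eval u / (q j).eval u₀) u₀ :=
        ((q j).continuous.div_const _).continuousAt
      refine hc.eventually_mem (isOpen_slitPlane.mem_nhds ?_)
      rw [div_self (hq₀ j)]
      exact one_mem_slitPlane
    exact Metric.eventually_nhds_iff_ball.1 (h1.and (eventually_all.2 h2))
  have hD0 : ∀ u ∈ ball u₀ r₀, u ≠ 0 := fun u hu h0 =>
    slitPlane_ne_zero (hrD u hu).1 (by rw [h0, zero_div])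
  have hDq : ∀ u ∈ ball u₀ r₀, ∀ j, (q j).eval u ≠ 0 := fun u hu j h0 =>
    slitPlane_ne_zero ((hrD u hu).2 j) (by rw [h0, zero_div])
  -- the local logarithms and `L`
  set ℓ₀ : ℂ → ℂ := fun u => log (u / u₀) + log u₀ with hℓ₀
  set ℓ : Fin s → ℂ → ℂ := fun j u => log ((q j).eval u / (q j).eval u₀) + log ((q j).eval u₀)
    with hℓ
  set L : ℂ → ℂ := fun u => ℓ₀ u - ∑ j, (r j : ℂ) * ℓ j u - c with hL
  have hexp₀ : ∀ u ∈ ball u₀ r₀, exp (ℓ₀ u) = u := by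
    intro u hu
    rw [hℓ₀, exp_add, exp_log (div_ne_zero (hD0 u hu) hu₀), exp_log hu₀, div_mul_cancel₀ _ hu₀]
  have hexp : ∀ u ∈ ball u₀ r₀, ∀ j, exp (ℓ j u) = (q j).eval u := by
    intro u hu j
    simp only [hℓ]
    rw [exp_add, exp_log (div_ne_zero (hDq u hu j) (hq₀ j)), exp_log (hq₀ j),
      div_mul_cancel₀ _ (hq₀ j)]
  -- derivatives
  have hdℓ₀ : ∀ u ∈ ball u₀ r₀, HasDerivAt ℓ₀ u⁻¹ u := by
    intro u hu
    have h1 : HasDerivAt (fun u : ℂ => u / u₀) (1 / u₀) u := (hasDerivAt_id u).div_const u₀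
    have h2 := (h1.clog (hrD u hu).1).add_const (log u₀)
    refine h2.congr_deriv ?_
    field_simp [hD0 u hu, hu₀]
  have hdℓ : ∀ u ∈ ball u₀ r₀, ∀ j,
      HasDerivAt (ℓ j) ((Polynomial.derivative (q j)).eval u / (q j).eval u) u := by
    intro u hu j
    have h1 : HasDerivAt (fun u : ℂ => (q j).eval u / (q j).eval u₀)
        ((Polynomial.derivative (q j)).eval u / (q j).eval u₀) u := ((q j).hasDerivAt u).div_const _
    have h2 := (h1.clog ((hrD u hu).2 j)).add_const (log ((q j).eval u₀))
    refine h2.congr_deriv ?_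
    field_simp [hDq u hu j, hq₀ j]
  have hdL : ∀ u ∈ ball u₀ r₀, HasDerivAt L
      (u⁻¹ - ∑ j, (r j : ℂ) * ((Polynomial.derivative (q j)).eval u / (q j).eval u)) u := by
    intro u hu
    have hs : HasDerivAt (fun u => ∑ j, (r j : ℂ) * ℓ j u)
        (∑ j, (r j : ℂ) * ((Polynomial.derivative (q j)).eval u / (q j).eval u)) u :=
      HasDerivAt.fun_sum fun j _ => (hdℓ u hu j).const_mul (r j : ℂ)
    exact ((hdℓ₀ u hu).sub hs).sub_const c
  have hdiff : DifferentiableOn ℂ L (ball u₀ r₀) := fun u hu =>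
    (hdL u hu).differentiableAt.differentiableWithinAt
  -- Step 1: local surjectivity of `L` near every point of the ball (open mapping theorem)
  have hsurj : ∀ u₁ ∈ ball u₀ r₀, ∀ ρ > (0 : ℝ), ∃ δ > (0 : ℝ), ∀ c' : ℂ, ‖c' - L u₁‖ < δ →
      ∃ u ∈ ball u₁ ρ, L u = c' := by
    intro u₁ hu₁ ρ hρ
    have han : AnalyticAt ℂ L u₁ := hdiff.analyticAt (isOpen_ball.mem_nhds hu₁)
    rcases han.eventually_constant_or_nhds_le_map_nhds with hconst | hmap
    · -- `L` locally constant: then `1/u = Σ rⱼ qⱼ'/qⱼ` near `u₁`, so `Σ rⱼ deg qⱼ = 1`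
      exfalso
      obtain ⟨ρ', hρ', hball⟩ := Metric.mem_nhds_iff.1
        (hconst.and (isOpen_ball.mem_nhds hu₁ : ball u₀ r₀ ∈ 𝓝 u₁))
      refine hdeg (sum_mul_natDegree_eq_one_of_prod_eq r hq ?_)
      refine Polynomial.eq_of_infinite_eval_eq _ _
        ((infinite_of_mem_nhds u₁ (ball_mem_nhds u₁ hρ')).mono fun u hu => ?_)
      have huD : u ∈ ball u₀ r₀ := (hball hu).2
      have hev : L =ᶠ[𝓝 u] fun _ => L u₁ :=
        Filter.eventually_of_mem (isOpen_ball.mem_nhds hu) fun v hv => (hball hv).1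
      have hd0 : deriv L u = 0 := by rw [hev.deriv_eq, deriv_const]
      rw [(hdL u huD).deriv] at hd0
      have hu0 := hD0 u huD
      have hqu := hDq u huD
      -- evaluate both sides
      simp only [Set.mem_setOf_eq, Polynomial.eval_prod, Polynomial.eval_mul, Polynomial.eval_X,
        Polynomial.eval_finsetSum, Polynomial.eval_C]
      have hprod : ∀ j, (q j).eval u * ∏ i ∈ Finset.univ.erase j, (q i).eval u =
          ∏ i, (q i).eval u := fun j =>
        Finset.mul_prod_erase Finset.univ (fun i => (q i).eval u) (Finset.mem_univ j)
      have hP0 : ∏ i, (q i).eval u ≠ 0 := Finset.prod_ne_zero_iff.2 fun i _ => hqu i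
      -- `Σ rⱼ qⱼ' ∏_{i≠j} qᵢ = (∏ qᵢ) · Σ rⱼ qⱼ'/qⱼ`
      have hsum : ∑ j, (r j : ℂ) * ((Polynomial.derivative (q j)).eval u *
          ∏ i ∈ Finset.univ.erase j, (q i).eval u) =
          (∏ i, (q i).eval u) * ∑ j, (r j : ℂ) * ((Polynomial.derivative (q j)).eval u /
            (q j).eval u) := by
        rw [Finset.mul_sum]
        refine Finset.sum_congr rfl fun j _ => ?_
        rw [← hprod j]
        field_simp [hqu j]
      rw [hsum]
      have h5 : ∑ j, (r j : ℂ) * ((Polynomial.derivative (q j)).eval u / (q j).eval u) = u⁻¹ := by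
        linear_combination -hd0
      rw [h5]
      field_simp
    · have hmem : L '' ball u₁ ρ ∈ 𝓝 (L u₁) := hmap (image_mem_map (ball_mem_nhds u₁ hρ))
      obtain ⟨δ, hδ, hsub⟩ := Metric.mem_nhds_iff.1 hmem
      refine ⟨δ, hδ, fun c' hc' => ?_⟩
      obtain ⟨u, hu, huc⟩ := hsub (mem_ball_iff_norm.2 hc')
      exact ⟨u, hu, huc⟩
  -- Step 2: `L u₀` is purely imaginary
  have hLre : (L u₀).re = 0 := by
    have h1 : L u₀ = log u₀ - ∑ j, (r j : ℂ) * log ((q j).eval u₀) - c := by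
      simp only [hL, hℓ₀, hℓ, div_self hu₀, div_self (hq₀ _), Complex.log_one, zero_add]
    rw [h1, sub_re, sub_re, re_sum, log_re, hlev]
    simp only [re_ofReal_mul, log_re]
    ring
  -- Step 3: the infinite set of accumulation values
  set A : Set ℂ := {u | u ∈ ball u₀ (r₀ / 2) ∧ (L u).re = 0} with hA
  have hr2 : 0 < r₀ / 2 := half_pos hr₀
  have hAD : ∀ u ∈ A, u ∈ ball u₀ r₀ := fun u hu =>
    mem_ball.2 ((mem_ball.1 hu.1).trans (half_lt_self hr₀))
  refine ⟨A, ?_, fun α hα => ?_⟩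
  · obtain ⟨δ, hδ, hδs⟩ := hsurj u₀ (mem_ball_self hr₀) (r₀ / 2) hr2
    obtain ⟨T, hT⟩ : ∃ T : ℝ, L u₀ = (T : ℂ) * I :=
      ⟨(L u₀).im, by
        conv_lhs => rw [← re_add_im (L u₀), hLre]
        push_cast
        ring⟩
    have key : ∀ t : Set.Ioo (T - δ) (T + δ), ∃ u ∈ ball u₀ (r₀ / 2), L u = (t : ℝ) * I := by
      intro t
      refine hδs _ ?_
      have h1 : ((t : ℝ) : ℂ) * I - L u₀ = (((t : ℝ) - T : ℝ) : ℂ) * I := by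
        rw [hT]
        push_cast
        ring
      rw [h1, norm_mul, norm_I, mul_one, norm_real, Real.norm_eq_abs, abs_lt]
      have := t.2
      constructor <;> linarith [this.1, this.2]
    choose f hf hfL using key
    haveI : Infinite (Set.Ioo (T - δ) (T + δ)) := Set.Ioo.infinite (by linarith)
    refine Set.infinite_of_injective_forall_mem (f := f) (fun t₁ t₂ h12 => ?_) fun t => ⟨hf t, ?_⟩
    · have h1 := hfL t₁
      rw [h12, hfL t₂] at h1
      have h2 := mul_right_cancel₀ I_ne_zero h1
      exact Subtype.ext (by exact_mod_cast h2.symm)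
    · rw [hfL t, mul_I_re, ofReal_im, neg_zero]
  · -- Step 4: sequences of exponential points accumulating at `α`
    have hαD : α ∈ ball u₀ r₀ := hAD α hα
    have hLα : L α = ((L α).im : ℂ) * I := by
      conv_lhs => rw [← re_add_im (L α), hα.2]
      push_cast
      ring
    have key : ∀ n : ℕ, ∃ u : ℂ, ∃ k m : ℤ, u ∈ ball α (min (r₀ / 2) (1 / ((n : ℝ) + 1))) ∧
        (n : ℤ) < |k| ∧ L u = ((m : ℂ) + (r j₀ : ℂ) * (k : ℂ)) * (2 * Real.pi * I) := by
      intro n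
      obtain ⟨δ, hδ, hδs⟩ := hsurj α hαD (min (r₀ / 2) (1 / ((n : ℝ) + 1)))
        (lt_min hr2 (by positivity))
      obtain ⟨k, m, hk, hkm⟩ := exists_int_int_near_of_irrational hj₀ ((L α).im / (2 * Real.pi))
        (div_pos hδ Real.two_pi_pos) n
      obtain ⟨u, hu, huL⟩ := hδs (((m : ℂ) + (r j₀ : ℂ) * (k : ℂ)) * (2 * Real.pi * I)) (by
        rw [hLα]
        have h1 : ((m : ℂ) + (r j₀ : ℂ) * (k : ℂ)) * (2 * Real.pi * I) - ((L α).im : ℂ) * I =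
            ((((m : ℝ) + r j₀ * k) * (2 * Real.pi) - (L α).im : ℝ) : ℂ) * I := by
          push_cast
          ring
        have h2 : ((m : ℝ) + r j₀ * k) * (2 * Real.pi) - (L α).im =
            ((m : ℝ) + r j₀ * k - (L α).im / (2 * Real.pi)) * (2 * Real.pi) := by
          rw [sub_mul, div_mul_cancel₀ _ (ne_of_gt Real.two_pi_pos)]
        rw [h1, norm_mul, norm_I, mul_one, norm_real, Real.norm_eq_abs, h2, abs_mul,
          abs_of_pos Real.two_pi_pos]
        exact (lt_div_iff₀ Real.two_pi_pos).1 hkm)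
      exact ⟨u, k, m, hu, hk, huL⟩
    choose u k m hu hk hLu using key
    have huD : ∀ n, u n ∈ ball u₀ r₀ := by
      intro n
      have h1 : dist (u n) α < r₀ / 2 := (mem_ball.1 (hu n)).trans_le (min_le_left _ _)
      have h2 : dist α u₀ < r₀ / 2 := mem_ball.1 hα.1
      exact mem_ball.2 (by linarith [dist_triangle (u n) α u₀])
    -- the exponential points: `xⱼ = ℓⱼ(u) + 2πik [j = j₀]`
    set x : ℕ → Fin s → ℂ := fun n j =>
      ℓ j (u n) + if j = j₀ then (k n : ℂ) * (2 * Real.pi * I) else 0 with hx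
    have hw : Tendsto u atTop (𝓝 α) := by
      rw [Metric.tendsto_atTop]
      intro ε hε
      obtain ⟨N, hN⟩ := exists_nat_one_div_lt hε
      refine ⟨N, fun n hn => ?_⟩
      have h1 : dist (u n) α < 1 / ((n : ℝ) + 1) :=
        (mem_ball.1 (hu n)).trans_le (min_le_right _ _)
      refine h1.trans_le ((one_div_le_one_div_of_le (by positivity) ?_).trans hN.le)
      exact_mod_cast Nat.succ_le_succ hn
    refine ⟨x, u, ?_, hw, fun n => ⟨fun j => ?_, ?_⟩⟩
    · -- `|x_n j₀| → ∞`
      have hxj₀ : ∀ n, x n j₀ = ℓ j₀ (u n) + (k n : ℂ) * (2 * Real.pi * I) := fun n => by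
        simp [hx]
      have hcont : ContinuousAt (ℓ j₀) α := (hdℓ α hαD j₀).continuousAt
      have hlim : Tendsto (fun n => ℓ j₀ (u n)) atTop (𝓝 (ℓ j₀ α)) := hcont.tendsto.comp hw
      obtain ⟨B, hB⟩ := isBounded_iff_forall_norm_le.1 (isBounded_range_of_tendsto _ hlim)
      have hlow : ∀ n : ℕ, 2 * Real.pi * ((n : ℝ) + 1) - B ≤ ‖x n j₀‖ := by
        intro n
        rw [hxj₀]
        have h1 : ‖(k n : ℂ) * (2 * Real.pi * I)‖ = 2 * Real.pi * |(k n : ℝ)| := by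
          rw [norm_mul, norm_intCast]
          simp [abs_of_pos Real.pi_pos]
          ring
        have h2 : ((n : ℝ) + 1) ≤ |(k n : ℝ)| := by
          have := hk n
          rw [← Int.cast_abs]
          exact_mod_cast this
        have h3 : ‖(k n : ℂ) * (2 * Real.pi * I)‖ ≤
            ‖ℓ j₀ (u n) + (k n : ℂ) * (2 * Real.pi * I)‖ + ‖ℓ j₀ (u n)‖ := by
          have := norm_sub_le (ℓ j₀ (u n) + (k n : ℂ) * (2 * Real.pi * I)) (ℓ j₀ (u n))
          rwa [add_sub_cancel_left] at this
        have h4 : ‖ℓ j₀ (u n)‖ ≤ B := hB _ ⟨n, rfl⟩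
        nlinarith [Real.pi_pos, h1, h2, h3, h4]
      refine tendsto_atTop_mono hlow ?_
      refine tendsto_atTop_add_const_right _ (-B) ?_
      exact (tendsto_natCast_atTop_atTop.atTop_add tendsto_const_nhds).const_mul_atTop
        Real.two_pi_pos
    · -- `e^{xⱼ} = qⱼ(w)`
      simp only [hx]
      split_ifs
      · rw [exp_add, hexp _ (huD n) j, exp_int_mul_two_pi_mul_I, mul_one]
      · rw [add_zero, hexp _ (huD n) j]
    · -- `e^{Σ rⱼ xⱼ + c} = w`
      have hsum : ∑ j, (r j : ℂ) * x n j =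
          ∑ j, (r j : ℂ) * ℓ j (u n) + (r j₀ : ℂ) * ((k n : ℂ) * (2 * Real.pi * I)) := by
        simp only [hx, mul_add, Finset.sum_add_distrib, mul_ite, mul_zero, Finset.sum_ite_eq',
          Finset.mem_univ, if_true]
      have h1 : ∑ j, (r j : ℂ) * x n j + c = ℓ₀ (u n) + ((-m n : ℤ) : ℂ) * (2 * Real.pi * I) := by
        have h2 := hLu n
        simp only [hL] at h2
        rw [hsum]
        push_cast
        linear_combination (-1 : ℂ) * h2
      rw [h1, exp_add, hexp₀ _ (huD n), exp_int_mul_two_pi_mul_I, mul_one]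

end SplitCore

end Summit.Schanuel.Schanuel.Theorems

end
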